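import Literature.Analysis.FluidPDE.QuasiSelfSimilarMoveSP02
import HarnessLib

/-!
# Straight move, phase 2: re-description certificates towards phase 3

Topic `Literature/Analysis/FluidPDE`. Emitted data / kernel certificates of the explicit straight generating
move (`S`) in the typed-chain model, under the contract of `PlanarGeneratorAssembly.lean`
(`acm_compatible_blocks_of_slots`). Generated by the author's emitter from the exact rational design;
no named facts, every theorem is decided in the kernel or assembled from decided chunks. [folklore]

## References

* G. Alberti, G. Crippa, A. L. Mazzucato, *Exponential self-similar mixing by incompressible
  flows*, J. Amer. Math. Soc. 32 (2019), 445–490, §8 (arXiv:1605.02090).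
-/

noncomputable section

namespace Literature.Analysis.FluidPDE.QuasiSelfSimilar.MoveS

open PlanarKinematics QuasiSelfSimilar

/-- Cover certificate of the end keyframe of phase 2 by the start keyframe of phase 3. [folklore] -/
def rc02 : List (Fin 2 × List (ℕ × EquivCert)) := [(0, [(0, .same)]), (0, [(1, .same)]), (0, [(2, .same)]), (0, [(3, .same)]), (1, [(4, .same), (5, (.gap 1 0 0 0 (mkRat (4571) 9000) (mkRat (4609) 9000)))]), (1, [(5, (.gap 0 0 0 0 (mkRat (4607) 9000) (mkRat (929) 1800))), (6, .flip)]), (0, [(7, .same)]), (0, [(8, .same)]), (0, [(9, .same)]), (1, [(11, (.gap 1 0 0 0 (mkRat (-929) 1800) (mkRat (-4607) 9000))), (10, .same)]), (1, [(12, .flip), (11, (.gap 0 0 0 0 (mkRat (-4609) 9000) (mkRat (-4571) 9000)))]), (0, [(13, .same)]), (0, [(14, .same)]), (0, [(15, .same)]), (1, [(17, (.gap 1 0 0 0 (mkRat (-4429) 9000) (mkRat (-4391) 9000))), (16, .same)]), (1, [(18, .flip), (17, (.gap 0 0 0 0 (mkRat (-4393) 9000) (mkRat (-871) 1800)))]),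 (0, [(19, .same)]), (0, [(20, .same)]), (0, [(21, .same)]), (1, [(22, .same), (23, (.gap 1 0 0 0 (mkRat (871) 1800) (mkRat (4393) 9000)))]), (1, [(23, (.gap 0 0 0 0 (mkRat (4391) 9000) (mkRat (4429) 9000))), (24, .flip)]), (0, [(25, .same)]), (0, [(26, .same)]), (0, [(27, .same)]), (0, [(28, .same)])]

/-- Cover certificate of the start keyframe of phase 3 by the end keyframe of phase 2. [folklore] -/
def rc02' : List (Fin 2 × List (ℕ × EquivCert)) := [(0, [(0, .same)]), (0, [(1, .same)]), (0, [(2, .same)]), (0, [(3, .same)]), (0, [(4, .same)]), (1, [(4, (.gap 0 0 1 0 (mkRat (3091) 4500) (mkRat (3119) 4500))), (5, (.gap 0 0 0 0 (mkRat (3109) 4500) (mkRat (3137) 4500)))]), (0, [(5, .flip)]), (0, [(6, .same)]), (0, [(7, .same)]), (0, [(8, .same)]), (0, [(9, .same)]), (1, [(10, (.gap 0 0 0 0 (mkRat (-419) 4500) (mkRat (-391) 4500))), (9, (.gap 0 0 1 0 (mkRat (-437) 4500) (mkRat (-409) 4500)))]), (0, [(10, .flip)]), (0, [(11, .same)]),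 (0, [(12, .same)]), (0, [(13, .same)]), (0, [(14, .same)]), (1, [(15, (.gap 0 0 0 0 (mkRat (409) 4500) (mkRat (437) 4500))), (14, (.gap 0 0 1 0 (mkRat (391) 4500) (mkRat (419) 4500)))]), (0, [(15, .flip)]), (0, [(16, .same)]), (0, [(17, .same)]), (0, [(18, .same)]), (0, [(19, .same)]), (1, [(19, (.gap 0 0 1 0 (mkRat (5863) 4500) (mkRat (5891) 4500))), (20, (.gap 0 0 0 0 (mkRat (5881) 4500) (mkRat (5909) 4500)))]), (0, [(20, .flip)]), (0, [(21, .same)]), (0, [(22, .same)]), (0, [(23, .same)]), (0, [(24, .same)])]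

end Literature.Analysis.FluidPDE.QuasiSelfSimilar.MoveS

end
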